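/-
Copyright (c) 2026 the pub-hodgecm-mathlib formalisation cell (harness21).  Prover seat hodgecm-mathlib-K2E5-p16 (g4): Track B «K2-LIT»,
hLiu418 = stmt-HodgeConjecture-24832, ROAD Φ organ Φ6b-4 (c⁺): the growth of `η` and of the continuation `Ξ` in `h`, uniformly on
`(α, β)`-BOXES `[a₁, a₂] × [b₁, b₂]` (`b₁ > 1`) — what the diagonal `W(s) = Ξ(y, h; a + s, b + s)` series of Road Φ sums; 2026-09-04.
-/
import Summits.HodgeConjecture.HodgeConjecture.Theorems.K2LiuHermTwoXiContinuation               -- ★ p858155 (this seat): `Ξ`, prefactor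
import HarnessLib

/-!
# Crux `HLiu418`, ROAD Φ, organ Φ6b-4 (c⁺): growth of `η(g, h; α, β)` and `Ξ(g, h; α, β)` in `h`, uniformly on `(α, β)`-boxes
# [Shimura1982, Thm 3.1 (ii)-type estimate, Case II, m = κ = 2]

Cell `hodgecm-mathlib`, crux item hLiu418 = `stmt-HodgeConjecture-24832`, route of record `HCCMUnconditional`; squad K2, LEAD F0P6-plan (g12), co-dealer
K2E5-plan (g5), prover K2E5-p16 (g4).  THEOREMS ONLY; lane `--supports stmt-HodgeConjecture-24832 --as helper`.

★ `norm_etaTwo_le` (file `K2LiuHermTwoEtaGrowth`) is uniform in `re α ∈ [a₁, a₂]` at FIXED `β`.  Along the diagonal `(α, β) = (a + s, b + s)`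
both exponents move, so the Fourier-expansion continuation needs the bound uniform on BOXES:
* `norm_etaTwo_le₂`: for `g > 0`, `a₁ ≤ a₂`, `1 < b₁ ≤ b₂` there is `C ≥ 0` with
  `|η(g, h; α, β)| ≤ C · e^{−Re tr(hg)} · (1 + tr h)^{2(a₂−2)⁺} · (1 + det(h)^{−(2−a₁)⁺})` for all `h > 0`, `re α ∈ [a₁, a₂]`, `re β ∈ [b₁, b₂]`
  (interpolation in BOTH exponents at the four corners `(aᵢ, bⱼ)` + ★ `integral_norm_etaTwoIntegrand_add_le`);
* `norm_xiEtaRhs_le₂`: for compact `K ⊂ ℂ`, `L ⊂ {re β > 1}` there are `C, N, N′ ≥ 0` with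
  `|Ξ(g, h; α, β)| ≤ C · e^{−2π Re tr(hg)} · (1 + tr h)^N · (1 + det(h)^{−N′})` for all `h > 0`, `α ∈ K`, `β ∈ L`.
HONEST LABEL.  Count-neutral helper of the K2_Liu road; it pays no socket by itself: `HC_CM` is proved only modulo the 7 printed citations
(2 remaining named inputs: hLiu418 = `stmt-HodgeConjecture-24832`, h413 = `stmt-HodgeConjecture-24833`) until rung 0 closes.
-/

set_option autoImplicit false
-- the mandated namespace repeats the single-problem summit's segment (`HodgeConjecture.HodgeConjecture`)
set_option linter.dupNamespace false

noncomputable section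

open Complex MeasureTheory Set
open scoped ComplexOrder ComplexConjugate

namespace Summit.HodgeConjecture.HodgeConjecture.Cruxes.HLiu418.K2LiuHermTwoEtaGrowthUniform

open Summit.HodgeConjecture.HodgeConjecture.Cruxes.HLiu418.K2LiuHermTwoGammaDefs
open Summit.HodgeConjecture.HodgeConjecture.Cruxes.HLiu418.K2LiuHermTwoGammaSiegelGindikin
open Summit.HodgeConjecture.HodgeConjecture.Cruxes.HLiu418.K2LiuHermTwoEtaDefs
open Summit.HodgeConjecture.HodgeConjecture.Cruxes.HLiu418.K2LiuHermTwoEtaConvergence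
open Summit.HodgeConjecture.HodgeConjecture.Cruxes.HLiu418.K2LiuHermTwoXiEtaIdentity
open Summit.HodgeConjecture.HodgeConjecture.Cruxes.HLiu418.K2LiuHermTwoEtaHolomorphy
open Summit.HodgeConjecture.HodgeConjecture.Cruxes.HLiu418.K2LiuHermTwoEtaGrowth
open Summit.HodgeConjecture.HodgeConjecture.Cruxes.HLiu418.K2LiuHermTwoXiContinuation

/-! ## Interpolation in `re β` -/

/-- INTERPOLATION IN `re β`: on the cone, for `b₁ ≤ re β ≤ b₂`,
`|η-integrand(γ, β)(u + h)| ≤ |η-integrand(γ, b₁)(u + h)| + |η-integrand(γ, b₂)(u + h)|`. -/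
theorem norm_etaTwoIntegrand_add_le_add_beta (d : ℝ × ℂ × ℝ) {e : ℝ × ℂ × ℝ} (he : (hermTwo e).PosDef) {u : ℝ × ℂ × ℝ}
    (hu : (hermTwo u).PosDef) (γ : ℂ) {β : ℂ} {b₁ b₂ : ℝ} (h₁ : b₁ ≤ β.re) (h₂ : β.re ≤ b₂) :
    ‖etaTwoIntegrand (hermTwo d) (hermTwo e) γ β (u + e)‖ ≤
      ‖etaTwoIntegrand (hermTwo d) (hermTwo e) γ (b₁ : ℂ) (u + e)‖ + ‖etaTwoIntegrand (hermTwo d) (hermTwo e) γ (b₂ : ℂ) (u + e)‖ := by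
  have hu' := (posDef_hermTwo_iff u).mp hu
  obtain ⟨a, z, b⟩ := u
  obtain ⟨ha, hz⟩ := hu'
  rw [norm_etaTwoIntegrand_add d he ha hz, norm_etaTwoIntegrand_add d he ha hz, norm_etaTwoIntegrand_add d he ha hz, ofReal_re, ofReal_re]
  have hD : 0 < a * b - normSq z := by linarith
  have h2e := (posDef_hermTwo_iff (e + e)).mp (by rw [hermTwo_add]; exact he.add he)
  have hdet2 : 0 < (a + (e.1 + e.1)) * (b + (e.2.2 + e.2.2)) - normSq (z + (e.2.1 + e.2.1)) := by
    have := det_add_ge (w := (e + e).2.1) (q := (e + e).2.2) ha hz h2e.1 h2e.2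
    simp only [Prod.fst_add, Prod.snd_add] at this
    linarith [h2e.2, show normSq (e + e).2.1 = normSq (e.2.1 + e.2.1) by rfl,
      show (e + e).1 * (e + e).2.2 = (e.1 + e.1) * (e.2.2 + e.2.2) by rfl]
  have hpow := Literature.Dynamics.TransferOperators.rpow_neg_le_add (a := 2 - β.re) (a₁ := 2 - b₂) (a₂ := 2 - b₁) hD
    (by linarith) (by linarith)
  rw [neg_sub, neg_sub, neg_sub] at hpow
  have hE : 0 ≤ Real.exp (-((a * d.1 + b * d.2.2 + 2 * (z * conj d.2.1).re) + (e.1 * d.1 + e.2.2 * d.2.2 + 2 * (e.2.1 * conj d.2.1).re))) :=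
    (Real.exp_pos _).le
  have hP : 0 ≤ ((a + (e.1 + e.1)) * (b + (e.2.2 + e.2.2)) - normSq (z + (e.2.1 + e.2.1))) ^ (γ.re - 2) := Real.rpow_nonneg hdet2.le _
  nlinarith [mul_nonneg hE hP, hpow]

/-- INTERPOLATION IN BOTH EXPONENTS at the four corners `(aᵢ, bⱼ)`. -/
theorem norm_etaTwoIntegrand_add_le_four (d : ℝ × ℂ × ℝ) {e : ℝ × ℂ × ℝ} (he : (hermTwo e).PosDef) {u : ℝ × ℂ × ℝ}
    (hu : (hermTwo u).PosDef) {γ β : ℂ} {a₁ a₂ b₁ b₂ : ℝ} (ha₁ : a₁ ≤ γ.re) (ha₂ : γ.re ≤ a₂) (hb₁ : b₁ ≤ β.re) (hb₂ : β.re ≤ b₂) :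
    ‖etaTwoIntegrand (hermTwo d) (hermTwo e) γ β (u + e)‖ ≤
      (‖etaTwoIntegrand (hermTwo d) (hermTwo e) (a₁ : ℂ) (b₁ : ℂ) (u + e)‖ +
        ‖etaTwoIntegrand (hermTwo d) (hermTwo e) (a₁ : ℂ) (b₂ : ℂ) (u + e)‖) +
      (‖etaTwoIntegrand (hermTwo d) (hermTwo e) (a₂ : ℂ) (b₁ : ℂ) (u + e)‖ +
        ‖etaTwoIntegrand (hermTwo d) (hermTwo e) (a₂ : ℂ) (b₂ : ℂ) (u + e)‖) :=
  (norm_etaTwoIntegrand_add_le_add d he hu ha₁ ha₂).trans (add_le_add (norm_etaTwoIntegrand_add_le_add_beta d he hu _ hb₁ hb₂)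
    (norm_etaTwoIntegrand_add_le_add_beta d he hu _ hb₁ hb₂))

/-! ## Growth of `η` uniformly on boxes -/

/-- **GROWTH OF `η(g, h; α, β)` IN `h`, UNIFORMLY ON `(α, β)`-BOXES**: for `g > 0`, `a₁ ≤ a₂` and `1 < b₁ ≤ b₂` there is `C ≥ 0` such that
for every positive definite `h` and all `α, β` with `re α ∈ [a₁, a₂]`, `re β ∈ [b₁, b₂]`,
  `|η(g, h; α, β)| ≤ C · e^{−Re tr(hg)} · (1 + tr h)^{2(a₂−2)⁺} · (1 + det(h)^{−(2−a₁)⁺})`. -/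
theorem norm_etaTwo_le₂ {g : Matrix (Fin 2) (Fin 2) ℂ} (hg : g.PosDef) {a₁ a₂ b₁ b₂ : ℝ} (h12 : a₁ ≤ a₂) (hb₁ : 1 < b₁) (hb12 : b₁ ≤ b₂) :
    ∃ C : ℝ, 0 ≤ C ∧ ∀ h : Matrix (Fin 2) (Fin 2) ℂ, h.PosDef → ∀ α β : ℂ, a₁ ≤ α.re → α.re ≤ a₂ → b₁ ≤ β.re → β.re ≤ b₂ →
      ‖etaTwo g h α β‖ ≤ C * Real.exp (-((h * g).trace).re) *
        ((1 + ((h 0 0).re + (h 1 1).re)) ^ (2 * max (a₂ - 2) 0) * (1 + ((h 0 0).re * (h 1 1).re - normSq (h 0 1)) ^ (-max (2 - a₁) 0))) := by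
  obtain ⟨d, rfl⟩ : ∃ d : ℝ × ℂ × ℝ, hermTwo d = g := ⟨_, hermTwo_eq_of_isHermitian hg.1⟩
  have hd := (posDef_hermTwo_iff d).mp hg
  have hb₂ : 1 < b₂ := lt_of_lt_of_le hb₁ hb12
  have hb₁' : 1 < ((b₁ : ℝ) : ℂ).re := by simpa using hb₁
  have hb₂' : 1 < ((b₂ : ℝ) : ℂ).re := by simpa using hb₂
  obtain ⟨C₁₁, hC₁₁, hB₁₁⟩ := integral_norm_etaTwoIntegrand_add_le hd hb₁' a₁
  obtain ⟨C₁₂, hC₁₂, hB₁₂⟩ := integral_norm_etaTwoIntegrand_add_le hd hb₂' a₁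
  obtain ⟨C₂₁, hC₂₁, hB₂₁⟩ := integral_norm_etaTwoIntegrand_add_le hd hb₁' a₂
  obtain ⟨C₂₂, hC₂₂, hB₂₂⟩ := integral_norm_etaTwoIntegrand_add_le hd hb₂' a₂
  refine ⟨(C₁₁ + C₁₂) + (C₂₁ + C₂₂), by positivity, fun h hh α β hα₁ hα₂ hβ₁ hβ₂ => ?_⟩
  obtain ⟨e, rfl⟩ : ∃ e : ℝ × ℂ × ℝ, hermTwo e = h := ⟨_, hermTwo_eq_of_isHermitian hh.1⟩
  have heh := (posDef_hermTwo_iff e).mp hh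
  have he2 : 0 < e.2.2 := snd_pos_of_cone heh.1 heh.2
  have hδ : 0 < e.1 * e.2.2 - normSq e.2.1 := by linarith [heh.2]
  have hβ : 1 < β.re := lt_of_lt_of_le hb₁ hβ₁
  simp only [trace_hermTwo_mul_hermTwo, hermTwo_apply_zero_zero, hermTwo_apply_one_one, hermTwo_apply_zero_one, ofReal_re]
  -- `|η| ≤ ∫ |η-int(α, β)| ≤ ∫ Σ corners`
  have hI := (integrableOn_etaTwoIntegrand_comp_add hg hh α hβ).norm
  have hI₁₁ := (integrableOn_etaTwoIntegrand_comp_add hg hh (a₁ : ℂ) hb₁').norm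
  have hI₁₂ := (integrableOn_etaTwoIntegrand_comp_add hg hh (a₁ : ℂ) hb₂').norm
  have hI₂₁ := (integrableOn_etaTwoIntegrand_comp_add hg hh (a₂ : ℂ) hb₁').norm
  have hI₂₂ := (integrableOn_etaTwoIntegrand_comp_add hg hh (a₂ : ℂ) hb₂').norm
  have step1 : ‖etaTwo (hermTwo d) (hermTwo e) α β‖ ≤
      ∫ u in {c : ℝ × ℂ × ℝ | (hermTwo c).PosDef}, ‖etaTwoIntegrand (hermTwo d) (hermTwo e) α β (u + e)‖ := by
    rw [etaTwo_eq_integral_comp_add (hermTwo d) hh.posSemidef]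
    exact norm_integral_le_integral_norm _
  have step2 : ∫ u in {c : ℝ × ℂ × ℝ | (hermTwo c).PosDef}, ‖etaTwoIntegrand (hermTwo d) (hermTwo e) α β (u + e)‖ ≤
      ∫ u in {c : ℝ × ℂ × ℝ | (hermTwo c).PosDef},
        ((‖etaTwoIntegrand (hermTwo d) (hermTwo e) (a₁ : ℂ) (b₁ : ℂ) (u + e)‖ +
          ‖etaTwoIntegrand (hermTwo d) (hermTwo e) (a₁ : ℂ) (b₂ : ℂ) (u + e)‖) +
        (‖etaTwoIntegrand (hermTwo d) (hermTwo e) (a₂ : ℂ) (b₁ : ℂ) (u + e)‖ +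
          ‖etaTwoIntegrand (hermTwo d) (hermTwo e) (a₂ : ℂ) (b₂ : ℂ) (u + e)‖)) :=
    setIntegral_mono_on hI ((hI₁₁.add hI₁₂).add (hI₂₁.add hI₂₂)) measurableSet_posDef_hermTwo
      fun u hu => norm_etaTwoIntegrand_add_le_four d hh hu hα₁ hα₂ hβ₁ hβ₂
  have hIa : Integrable (fun u : ℝ × ℂ × ℝ => ‖etaTwoIntegrand (hermTwo d) (hermTwo e) (a₁ : ℂ) (b₁ : ℂ) (u + e)‖ +
      ‖etaTwoIntegrand (hermTwo d) (hermTwo e) (a₁ : ℂ) (b₂ : ℂ) (u + e)‖) (volume.restrict {c : ℝ × ℂ × ℝ | (hermTwo c).PosDef}) :=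
    hI₁₁.add hI₁₂
  have hIb : Integrable (fun u : ℝ × ℂ × ℝ => ‖etaTwoIntegrand (hermTwo d) (hermTwo e) (a₂ : ℂ) (b₁ : ℂ) (u + e)‖ +
      ‖etaTwoIntegrand (hermTwo d) (hermTwo e) (a₂ : ℂ) (b₂ : ℂ) (u + e)‖) (volume.restrict {c : ℝ × ℂ × ℝ | (hermTwo c).PosDef}) :=
    hI₂₁.add hI₂₂
  rw [integral_add hIa hIb, integral_add hI₁₁ hI₁₂, integral_add hI₂₁ hI₂₂] at step2
  have hB₁₁' := hB₁₁ e hh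
  have hB₁₂' := hB₁₂ e hh
  have hB₂₁' := hB₂₁ e hh
  have hB₂₂' := hB₂₂ e hh
  -- monotonicity of the profile factors in the exponents (as in ★ `norm_etaTwo_le`)
  have hE : (1 : ℝ) ≤ 1 + (e.1 + e.2.2) := by linarith [heh.1]
  have hP : 0 ≤ (1 + (e.1 + e.2.2)) ^ (2 * max (a₂ - 2) 0) := Real.rpow_nonneg (by linarith) _
  have hm₁ : (1 + (e.1 + e.2.2)) ^ (2 * max (a₁ - 2) 0) ≤ (1 + (e.1 + e.2.2)) ^ (2 * max (a₂ - 2) 0) :=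
    Real.rpow_le_rpow_of_exponent_le hE (by linarith [max_le_max (sub_le_sub_right h12 2) (le_refl (0 : ℝ))])
  have hn₁ : (e.1 * e.2.2 - normSq e.2.1) ^ (-max (2 - a₁) 0) ≤ 1 + (e.1 * e.2.2 - normSq e.2.1) ^ (-max (2 - a₁) 0) := by linarith
  have hn₂ : (e.1 * e.2.2 - normSq e.2.1) ^ (-max (2 - a₂) 0) ≤ 1 + (e.1 * e.2.2 - normSq e.2.1) ^ (-max (2 - a₁) 0) := by
    have h := Literature.Dynamics.TransferOperators.rpow_neg_le_add (a := max (2 - a₂) 0) (a₁ := 0) (a₂ := max (2 - a₁) 0) hδ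
      (le_max_right _ _) (max_le_max (by linarith) (le_refl (0 : ℝ)))
    rwa [neg_zero, Real.rpow_zero] at h
  have key₁ : (1 + (e.1 + e.2.2)) ^ (2 * max (a₁ - 2) 0) * (e.1 * e.2.2 - normSq e.2.1) ^ (-max (2 - a₁) 0) ≤
      (1 + (e.1 + e.2.2)) ^ (2 * max (a₂ - 2) 0) * (1 + (e.1 * e.2.2 - normSq e.2.1) ^ (-max (2 - a₁) 0)) :=
    mul_le_mul hm₁ hn₁ (Real.rpow_nonneg hδ.le _) hP
  have key₂ : (1 + (e.1 + e.2.2)) ^ (2 * max (a₂ - 2) 0) * (e.1 * e.2.2 - normSq e.2.1) ^ (-max (2 - a₂) 0) ≤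
      (1 + (e.1 + e.2.2)) ^ (2 * max (a₂ - 2) 0) * (1 + (e.1 * e.2.2 - normSq e.2.1) ^ (-max (2 - a₁) 0)) :=
    mul_le_mul_of_nonneg_left hn₂ hP
  have hX0 := (Real.exp_pos (-(e.1 * d.1 + e.2.2 * d.2.2 + 2 * (e.2.1 * conj d.2.1).re))).le
  have hX₁₁ := mul_le_mul_of_nonneg_left key₁ (mul_nonneg hC₁₁ hX0)
  have hX₁₂ := mul_le_mul_of_nonneg_left key₁ (mul_nonneg hC₁₂ hX0)
  have hX₂₁ := mul_le_mul_of_nonneg_left key₂ (mul_nonneg hC₂₁ hX0)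
  have hX₂₂ := mul_le_mul_of_nonneg_left key₂ (mul_nonneg hC₂₂ hX0)
  linarith [step1, step2, hB₁₁', hB₁₂', hB₂₁', hB₂₂', hX₁₁, hX₁₂, hX₂₁, hX₂₂]

/-! ## Growth of `Ξ` locally uniformly in `(α, β)` -/

/-- The full prefactor `(α, β) ↦ 4π⁴ e^{iπ(β−α)} Γ₂(α)⁻¹ Γ₂(β)⁻¹` is continuous on `ℂ × ℂ`. -/
theorem continuous_xiEtaPrefactor₂ :
    Continuous (fun z : ℂ × ℂ => ((4 * Real.pi ^ 4 : ℝ) : ℂ) * cexp ((Real.pi * I) * (z.2 - z.1)) * (hermTwoGamma z.1)⁻¹ * (hermTwoGamma z.2)⁻¹) :=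
  ((continuous_const.mul ((continuous_const.mul (continuous_snd.sub continuous_fst)).cexp)).mul
    (differentiable_hermTwoGamma_inv.continuous.comp continuous_fst)).mul (differentiable_hermTwoGamma_inv.continuous.comp continuous_snd)

/-- **GROWTH OF `Ξ(g, h; α, β)` IN `h`, LOCALLY UNIFORMLY IN `(α, β)`**: for `g > 0` and compact `K ⊂ ℂ`, `L ⊂ {re β > 1}` there are
`C, N, N′ ≥ 0` such that for every positive definite `h`, every `α ∈ K` and every `β ∈ L`,
  `|4π⁴ e^{iπ(β−α)} Γ₂(α)⁻¹ Γ₂(β)⁻¹ η(2g, πh; α, β)| ≤ C · e^{−2π Re tr(hg)} · (1 + tr h)^N · (1 + det(h)^{−N′})`. -/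
theorem norm_xiEtaRhs_le₂ {g : Matrix (Fin 2) (Fin 2) ℂ} (hg : g.PosDef) {K L : Set ℂ} (hK : IsCompact K) (hL : IsCompact L)
    (hL1 : ∀ β ∈ L, 1 < β.re) :
    ∃ C N N' : ℝ, 0 ≤ C ∧ 0 ≤ N ∧ 0 ≤ N' ∧ ∀ h : Matrix (Fin 2) (Fin 2) ℂ, h.PosDef → ∀ α ∈ K, ∀ β ∈ L,
      ‖((4 * Real.pi ^ 4 : ℝ) : ℂ) * cexp ((Real.pi * I) * (β - α)) * (hermTwoGamma α)⁻¹ * (hermTwoGamma β)⁻¹ *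
          etaTwo ((2 : ℂ) • g) ((Real.pi : ℂ) • h) α β‖ ≤
        C * Real.exp (-(2 * Real.pi * ((h * g).trace).re)) * (1 + ((h 0 0).re + (h 1 1).re)) ^ N *
          (1 + ((h 0 0).re * (h 1 1).re - normSq (h 0 1)) ^ (-N')) := by
  -- the boxes: `|re α| ≤ R` on `K`; `b₁ ≤ re β ≤ b₂` on `L` with `b₁ > 1`
  obtain ⟨R₀, hR₀⟩ := hK.isBounded.subset_closedBall 0
  set R : ℝ := |R₀| with hR
  have hstrip : ∀ α ∈ K, -R ≤ α.re ∧ α.re ≤ R := fun α hα =>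
    abs_le.mp (((Complex.abs_re_le_norm α).trans (mem_closedBall_zero_iff.mp (hR₀ hα))).trans (le_abs_self R₀))
  rcases L.eq_empty_or_nonempty with hLe | hLne
  · refine ⟨0, 0, 0, le_rfl, le_rfl, le_rfl, fun h _ α _ β hβ => ?_⟩
    rw [hLe] at hβ
    exact absurd hβ (Set.notMem_empty β)
  obtain ⟨βm, hβm, hβmin⟩ := (hL.image Complex.continuous_re).exists_isLeast (hLne.image _)
  obtain ⟨βM, hβM, hβmax⟩ := (hL.image Complex.continuous_re).exists_isGreatest (hLne.image _)
  have hbox : ∀ β ∈ L, βm ≤ β.re ∧ β.re ≤ βM := fun β hβ =>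
    ⟨hβmin (Set.mem_image_of_mem _ hβ), hβmax (Set.mem_image_of_mem _ hβ)⟩
  have hb₁1 : 1 < βm := by
    obtain ⟨β₁, hβ₁L, hβ₁eq⟩ := hβm
    rw [← hβ₁eq]
    exact hL1 β₁ hβ₁L
  have hb12 : βm ≤ βM := by
    obtain ⟨β₁, hβ₁L, hβ₁eq⟩ := hβm
    rw [← hβ₁eq]
    exact (hbox β₁ hβ₁L).2
  -- the prefactor is bounded on `K × L`
  obtain ⟨M, hM⟩ := (hK.prod hL).exists_bound_of_continuousOn continuous_xiEtaPrefactor₂.continuousOn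
  -- the growth of `η` at `(2g, πh)` on the box
  obtain ⟨d, rfl⟩ : ∃ d : ℝ × ℂ × ℝ, hermTwo d = g := ⟨_, hermTwo_eq_of_isHermitian hg.1⟩
  have h2 : (2 : ℂ) • hermTwo d = hermTwo ((2 : ℝ) • d) := by rw [hermTwo_smul]; norm_num
  have h2g : (hermTwo ((2 : ℝ) • d)).PosDef := posDef_hermTwo_smul two_pos hg
  obtain ⟨C, hC, hB⟩ := norm_etaTwo_le₂ h2g (a₁ := -R) (a₂ := R) (by linarith [abs_nonneg R₀]) hb₁1 hb12
  set N : ℝ := 2 * max (R - 2) 0 with hN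
  set N' : ℝ := max (2 - -R) 0 with hN'
  have hN0 : 0 ≤ N := by positivity
  have hN'0 : 0 ≤ N' := le_max_right _ _
  refine ⟨max M 0 * (C * Real.pi ^ N), N, N', by positivity, hN0, hN'0, fun h hh α hα β hβ => ?_⟩
  obtain ⟨e, rfl⟩ : ∃ e : ℝ × ℂ × ℝ, hermTwo e = h := ⟨_, hermTwo_eq_of_isHermitian hh.1⟩
  have heh := (posDef_hermTwo_iff e).mp hh
  have he1 : 0 < e.1 := heh.1
  have he2 : 0 < e.2.2 := snd_pos_of_cone heh.1 heh.2
  have hδ : 0 < e.1 * e.2.2 - normSq e.2.1 := by linarith [heh.2]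
  have hπe : (hermTwo (Real.pi • e)).PosDef := posDef_hermTwo_smul Real.pi_pos hh
  have hη := hB (hermTwo (Real.pi • e)) hπe α β (hstrip α hα).1 (hstrip α hα).2 (hbox β hβ).1 (hbox β hβ).2
  simp only [hermTwo_apply_zero_zero, hermTwo_apply_one_one, hermTwo_apply_zero_one, Prod.smul_fst, Prod.smul_snd, smul_eq_mul,
    Complex.real_smul, ofReal_re, trace_hermTwo_mul_hermTwo, map_mul, normSq_ofReal] at hη
  simp only [hermTwo_apply_zero_zero, hermTwo_apply_one_one, hermTwo_apply_zero_one, ofReal_re, trace_hermTwo_mul_hermTwo]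
  rw [h2, ← hermTwo_smul, norm_mul]
  have hT : Real.pi * e.1 * (2 * d.1) + Real.pi * e.2.2 * (2 * d.2.2) +
      2 * ((Real.pi : ℂ) * e.2.1 * (conj ((2 : ℝ) : ℂ) * conj d.2.1)).re =
      2 * Real.pi * (e.1 * d.1 + e.2.2 * d.2.2 + 2 * (e.2.1 * conj d.2.1).re) := by
    simp only [Complex.conj_ofReal, Complex.mul_re, Complex.mul_im, Complex.conj_re, Complex.conj_im, Complex.ofReal_re,
      Complex.ofReal_im]
    ring
  have hdet : Real.pi * e.1 * (Real.pi * e.2.2) - Real.pi * Real.pi * normSq e.2.1 = Real.pi ^ 2 * (e.1 * e.2.2 - normSq e.2.1) := by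
    ring
  rw [hT, hdet] at hη
  have hπ3 := Real.pi_gt_three
  have htr : (1 + (Real.pi * e.1 + Real.pi * e.2.2)) ^ N ≤ Real.pi ^ N * (1 + (e.1 + e.2.2)) ^ N := by
    rw [← Real.mul_rpow Real.pi_pos.le (by linarith [heh.1])]
    exact Real.rpow_le_rpow (by nlinarith [heh.1]) (by nlinarith [heh.1]) hN0
  have hdt : 1 + (Real.pi ^ 2 * (e.1 * e.2.2 - normSq e.2.1)) ^ (-N') ≤ 1 + (e.1 * e.2.2 - normSq e.2.1) ^ (-N') := by
    rw [Real.mul_rpow (by positivity) hδ.le]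
    have h1 : (Real.pi ^ 2) ^ (-N') ≤ 1 := Real.rpow_le_one_of_one_le_of_nonpos (by nlinarith) (by linarith)
    nlinarith [Real.rpow_nonneg hδ.le (-N')]
  have hP : 0 ≤ Real.pi ^ N * (1 + (e.1 + e.2.2)) ^ N := by positivity
  have hQ : 0 ≤ 1 + (Real.pi ^ 2 * (e.1 * e.2.2 - normSq e.2.1)) ^ (-N') := by
    linarith [Real.rpow_nonneg (show (0 : ℝ) ≤ Real.pi ^ 2 * (e.1 * e.2.2 - normSq e.2.1) by positivity) (-N')]
  have hη' := hη.trans (mul_le_mul_of_nonneg_left (mul_le_mul htr hdt hQ hP)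
    (mul_nonneg hC (Real.exp_pos (-(2 * Real.pi * (e.1 * d.1 + e.2.2 * d.2.2 + 2 * (e.2.1 * conj d.2.1).re)))).le))
  have hpre : ‖((4 * Real.pi ^ 4 : ℝ) : ℂ) * cexp ((Real.pi * I) * (β - α)) * (hermTwoGamma α)⁻¹ * (hermTwoGamma β)⁻¹‖ ≤ max M 0 :=
    (hM (α, β) (Set.mk_mem_prod hα hβ)).trans (le_max_left _ _)
  calc ‖((4 * Real.pi ^ 4 : ℝ) : ℂ) * cexp ((Real.pi * I) * (β - α)) * (hermTwoGamma α)⁻¹ * (hermTwoGamma β)⁻¹‖ *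
        ‖etaTwo (hermTwo ((2 : ℝ) • d)) (hermTwo (Real.pi • e)) α β‖
      ≤ max M 0 * (C * Real.exp (-(2 * Real.pi * (e.1 * d.1 + e.2.2 * d.2.2 + 2 * (e.2.1 * conj d.2.1).re))) *
          (Real.pi ^ N * (1 + (e.1 + e.2.2)) ^ N * (1 + (e.1 * e.2.2 - normSq e.2.1) ^ (-N')))) :=
        mul_le_mul hpre hη' (norm_nonneg _) (le_max_right _ _)
    _ = _ := by ring

end Summit.HodgeConjecture.HodgeConjecture.Cruxes.HLiu418.K2LiuHermTwoEtaGrowthUniform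

end
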